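import Mathlib
import Summits.CriticalPhenomena.CardyFormulaZ2.Theorems.CardyMagicRigidityPositiveConeJointDefs
import Summits.CriticalPhenomena.CardyFormulaZ2.Theorems.CardyMagicRigidityNestingRigidityTameRigidityWitness
import Summits.CriticalPhenomena.CardyFormulaZ2.Theorems.CardyMagicRigidityNestingRigidityTreeRigidityFamilySwitchConfigs
import Summits.CriticalPhenomena.CardyFormulaZ2.Theorems.CardyMagicRigidityNestingRigidityTreeRigidityTypedReconstruction
import Summits.CriticalPhenomena.CardyFormulaZ2.Theorems.CardyMagicRigidityNestingRigidityTransferReduction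
import Literature.Barriers.CriticalPhenomena.NestingTransformBlindness
import Literature.Probability.RandomPlanarGeometry.LocFinLoopConfig
import HarnessLib

/-!
# `tame_rigidity` is false, V: the law-level reading (route gap for `TreeRigidityTame`)

Crux `Summit.CriticalPhenomena.CardyFormulaZ2.Theses.CardyMagicRigidity.NestingRigidity`
(stmt-CriticalPhenomena-4835), line `positive-cone-weight-doubling`.  Companion of `…TameRigidityWitness`
(p132831: two TAME unbased loops `u ≠ v`, the two-mouth-lake loop `L` and its rotation `−L`, with the same
winding function, `dist u v ≥ 1/2`).  Here, in the shape of `exists_regular_laws_patternCount_eq_le_cnLawEDist`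
(p120899) and `exists_regular_laws_familywise_eq_jointly_ne` (p129546), the consequence for the reshaped
identification step `TreeRigidityTame` / `TamePrecompact` of `Theorems/CardyMagicRigidityPositiveConeJointDefs.lean`:

`exists_tame_laws_windEq_le_cnLawEDist` (anchor) — two random configurations on `([0,1], Leb)` (the Dirac
laws at the one-loop configurations `{u}`, `{v}`, both filed under type `0`), surely `Regular` AND `Tame`, whose
loops have IDENTICAL winding functions — so that every TYPED JOINT pattern count of every disc family, window and
index set coincides surely (all these statistics are functions of `(trace, W, type)`), hence
`TypedJointNestingLawAgreement`-type hypotheses cannot tell them apart — at coupling distance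
`cnLawEDist ≥ 1/2` (`udist u v ≥ 1/2`: the oriented distance is `≥ 1/2` by p132831, and a reversing matching
closer than `1/2 ≤ dist(3i/2, trace)` would give `W(v.reverse, 3i/2) = W(u, 3i/2)`, i.e. `−1 = 1`).

MORAL (route gap, fourth after G1–G3 of the audit of `stub_treeRigidity`): on supports containing tame loops with
a pair of crossing double-point chords (two-mouth lakes; generic for CLE₆-type limits), NO statement whose
hypotheses only constrain the laws of functionals of `(trace, W, type)` of the loops can conclude
`cnLawEDist → 0`; the identification must either be made at the level of winding functions (loops modulo
re-routing), or use an observable that sees the routing at pinch points.  Also: any tame loop alone is a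
`Regular` configuration (`TwoMouth.regular_single`).
-/

noncomputable section

open MeasureTheory Set Metric Complex Filter Topology
open scoped Real ENNReal

namespace Summit.CriticalPhenomena.CardyFormulaZ2.Cruxes.NestingRigidity.PositiveConeWeightDoubling

open Literature.Probability.RandomPlanarGeometry
open Literature.Barriers.CriticalPhenomena.NestingBlind (single loops_single mem_single_self)
open Summit.CriticalPhenomena.CardyFormulaZ2.Theses.CardyMagicRigidity
open Summit.CriticalPhenomena.CardyFormulaZ2.Cruxes.NestingRigidity.RingCloudTomography
  (patternCount_eq_of_interiorEquiv)
open NeedleLoops (isLoop_ofPath)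

namespace TwoMouth

/-! ## §1 A tame loop alone is a regular configuration; typed counts of one-loop configurations -/

/-- **Any tame loop, filed alone under one type, is a `Regular` configuration** (degree one and the boundary
property are clauses of `Tame`; local finiteness, laminarity and separation are automatic for one loop). -/
theorem regular_single {w : UnbasedLoop ℂ} (hw : Tame w) (i : Fin 2) : Regular (single i w) := by
  have hmem : ∀ v ∈ (single i w).loops, v = w := fun v hv ↦ by simpa using hv
  refine ⟨?_, fun v hv z ↦ ?_, fun v hv ↦ ?_, fun v hv v' hv' ↦ ?_, fun v hv v' hv' _ ↦ ?_⟩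
  · exact LoopConfig.IsLocallyFinite.of_finite fun j ↦ by fin_cases i <;> fin_cases j <;> simp [single]
  · rw [hmem v hv]
    rcases hw.signedDegreeOne with h | h <;> rcases h z with h' | h' <;> simp [h']
  · rw [hmem v hv]; exact hw.boundary
  · rw [hmem v hv, hmem v' hv']; exact Or.inl subset_rfl
  · rw [hmem v hv, hmem v' hv']; exact Or.inl rfl

/-- Membership in a family of `single 0 w`. -/
theorem eq_of_mem_single_F {w v : UnbasedLoop ℂ} {i : Fin 2} (h : v ∈ (single 0 w).F i) : v = w ∧ i = 0 := by
  fin_cases i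
  · simpa [single] using h
  · simp [single] at h

/-- **Equal winding functions ⇒ equal typed pattern counts** for one-loop configurations of tame loops (all
pattern counts are functions of trace and winding interior, `patternCount_eq_of_interiorEquiv`). -/
theorem typedPatternCount_single_eq {u v : UnbasedLoop ℂ} (hu : Tame u) (hv : Tame v)
    (h : ∀ z, u.wind z = v.wind z) (i : Fin 2) {n : ℕ} (x : Fin n → ℂ) (r : Fin n → ℝ) (R : ℝ)
    (S : Finset (Fin n)) : typedPatternCount (single 0 u) i x r R S = typedPatternCount (single 0 v) i x r R S := by
  unfold typedPatternCount
  have hint : {z | u.wind z ≠ 0} = {z | v.wind z ≠ 0} := by ext z; rw [mem_setOf_eq, mem_setOf_eq, h]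
  have lu : ∀ w, w ∈ (⟨fun j ↦ if j = i then (single 0 u).F i else ∅⟩ : LoopConfig ℂ).loops ↔
      w ∈ (single 0 u).F i := fun w ↦ by rw [loops_typeRestrict]
  have lv : ∀ w, w ∈ (⟨fun j ↦ if j = i then (single 0 v).F i else ∅⟩ : LoopConfig ℂ).loops ↔
      w ∈ (single 0 v).F i := fun w ↦ by rw [loops_typeRestrict]
  have huv : ∀ {w}, w ∈ (single 0 u).F i → v ∈ (single 0 v).F i := fun hw ↦ by
    obtain ⟨-, rfl⟩ := eq_of_mem_single_F hw; exact mem_single_self 0 v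
  have hvu : ∀ {w}, w ∈ (single 0 v).F i → u ∈ (single 0 u).F i := fun hw ↦ by
    obtain ⟨-, rfl⟩ := eq_of_mem_single_F hw; exact mem_single_self 0 u
  let e : (⟨fun j ↦ if j = i then (single 0 u).F i else ∅⟩ : LoopConfig ℂ).loops ≃
      (⟨fun j ↦ if j = i then (single 0 v).F i else ∅⟩ : LoopConfig ℂ).loops :=
    { toFun := fun w ↦ ⟨v, (lv v).2 (huv ((lu w).1 w.2))⟩
      invFun := fun w ↦ ⟨u, (lu u).2 (hvu ((lv w).1 w.2))⟩
      left_inv := fun w ↦ Subtype.ext (eq_of_mem_single_F ((lu w).1 w.2)).1.symm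
      right_inv := fun w ↦ Subtype.ext (eq_of_mem_single_F ((lv w).1 w.2)).1.symm }
  refine patternCount_eq_of_interiorEquiv (fun w hw ↦ ?_) (fun w hw ↦ ?_) e (fun w ↦ ?_) x r R S
  · rw [(eq_of_mem_single_F ((lu w).1 hw)).1]; exact hu.boundary
  · rw [(eq_of_mem_single_F ((lv w).1 hw)).1]; exact hv.boundary
  · rw [show ((e w : _) : UnbasedLoop ℂ) = v from rfl, (eq_of_mem_single_F ((lu w).1 w.2)).1, hint]

/-! ## §2 The two loops: winding functions, traces, `udist ≥ 1/2` -/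

/-- The trace of the two-mouth lake lies in the closed disc of radius `2`. -/
theorem norm_le_two_of_mem_trace {y : ℂ} (hy : y ∈ sphere (0 : ℂ) 2 ∪ sphere (-1) 1 ∪ sphere 1 1) : ‖y‖ ≤ 2 := by
  rw [mem_trace_iff] at hy
  rcases hy with h | h | h
  · exact h.le
  · calc ‖y‖ = ‖(y + 1) - 1‖ := by ring_nf
      _ ≤ ‖y + 1‖ + ‖(1 : ℂ)‖ := norm_sub_le _ _
      _ = 2 := by rw [h, norm_one]; norm_num
  · calc ‖y‖ = ‖(y - 1) + 1‖ := by ring_nf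
      _ ≤ ‖y - 1‖ + ‖(1 : ℂ)‖ := norm_add_le _ _
      _ = 2 := by rw [h, norm_one]; norm_num

/-- The point `3i/2` is at distance `≥ 1/2` from the trace. -/
theorem half_le_dist_of_mem_trace {y : ℂ} (hy : y ∈ sphere (0 : ℂ) 2 ∪ sphere (-1) 1 ∪ sphere 1 1) :
    1 / 2 ≤ dist ((3 / 2 : ℂ) * I) y := by
  have hz : ‖(3 / 2 : ℂ) * I‖ = 3 / 2 := by simp
  rw [mem_trace_iff] at hy
  rw [dist_eq_norm]
  rcases hy with h | h | h
  · have := norm_sub_norm_le y ((3 / 2 : ℂ) * I)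
    rw [h, hz, ← norm_neg, neg_sub] at this
    linarith
  · have h1 : (3 / 2 : ℝ) ≤ ‖(3 / 2 : ℂ) * I + 1‖ := by
      have : ‖(3 / 2 : ℂ) * I + 1‖ ^ 2 = 13 / 4 := by
        rw [Literature.Probability.Process.norm_sq_eq_re_sq_add_im_sq]; simp; norm_num
      nlinarith [norm_nonneg ((3 / 2 : ℂ) * I + 1)]
    have := norm_sub_norm_le ((3 / 2 : ℂ) * I + 1) (y + 1)
    rw [h, show (3 / 2 : ℂ) * I + 1 - (y + 1) = (3 / 2 : ℂ) * I - y by ring] at this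
    linarith
  · have h1 : (3 / 2 : ℝ) ≤ ‖(3 / 2 : ℂ) * I - 1‖ := by
      have : ‖(3 / 2 : ℂ) * I - 1‖ ^ 2 = 13 / 4 := by
        rw [Literature.Probability.Process.norm_sq_eq_re_sq_add_im_sq]; simp; norm_num
      nlinarith [norm_nonneg ((3 / 2 : ℂ) * I - 1)]
    have := norm_sub_norm_le ((3 / 2 : ℂ) * I - 1) (y - 1)
    rw [h, show (3 / 2 : ℂ) * I - 1 - (y - 1) = (3 / 2 : ℂ) * I - y by ring] at this
    linarith

/-- The point `3i/2` lies in the winding interior. -/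
theorem threeHalves_I_mem : ‖(3 / 2 : ℂ) * I‖ < 2 ∧ 1 < ‖(3 / 2 : ℂ) * I + 1‖ ∧ 1 < ‖(3 / 2 : ℂ) * I - 1‖ := by
  simp only [norm_lt_two_iff, one_lt_norm_iff, add_re, add_im, one_re, one_im, sub_re, sub_im, mul_re, mul_im,
    I_re, I_im]
  norm_num

/-- **The two tame loops of the refutation**, with their common winding function, common trace, and
`udist ≥ 1/2` (oriented: p132831; reversing: the sign of `W` at `3i/2`). -/
theorem exists_pair : ∃ u v : UnbasedLoop ℂ, Tame u ∧ Tame v ∧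
    (∀ z, u.wind z = if ‖z‖ < 2 ∧ 1 < ‖z + 1‖ ∧ 1 < ‖z - 1‖ then 1 else 0) ∧
    (∀ z, v.wind z = if ‖z‖ < 2 ∧ 1 < ‖z + 1‖ ∧ 1 < ‖z - 1‖ then 1 else 0) ∧
    u.range = sphere (0 : ℂ) 2 ∪ sphere (-1) 1 ∪ sphere 1 1 ∧ 1 / 2 ≤ u.udist v := by
  obtain ⟨U, D, a, b, c, d, hU, hD, ha, hb, hc, hd⟩ := exists_arcs
  have hr := range_loop hU hD ha hb hc hd
  have hw := wind_loop hU hD ha hb hc hd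
  have h2 := atMostDouble_loop hU hD ha hb hc hd
  have hdist := half_le_dist hU hD ha hb hc hd
  set u := UnbasedLoop.mk (BasedLoop.mk (CurveClass.mk (Curve.ofPath ((U.trans D).trans
    ((d.trans b).trans (a.trans c))))) (CurveClass.isLoop_mk.2 (isLoop_ofPath _))) with huq
  set v := UnbasedLoop.mk (BasedLoop.mk (CurveClass.mk (Curve.ofPath (((U.trans D).trans
    ((d.trans b).trans (a.trans c))).map continuous_neg))) (CurveClass.isLoop_mk.2 (isLoop_ofPath _))) with hvq
  have hwu : ∀ z, u.wind z = if ‖z‖ < 2 ∧ 1 < ‖z + 1‖ ∧ 1 < ‖z - 1‖ then 1 else 0 := hw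
  have hwv : ∀ z, v.wind z = if ‖z‖ < 2 ∧ 1 < ‖z + 1‖ ∧ 1 < ‖z - 1‖ then 1 else 0 := wind_neg _ hw
  have hru : u.range = sphere (0 : ℂ) 2 ∪ sphere (-1) 1 ∪ sphere 1 1 := hr
  refine ⟨u, v, tame_of_spec _ hr hw h2, tame_of_spec _ (range_neg _ hr) (wind_neg _ hw) (atMostDouble_neg _ h2),
    hwu, hwv, hru, ?_⟩
  rw [UnbasedLoop.udist_def, le_min_iff]
  refine ⟨hdist, not_lt.1 fun hlt ↦ ?_⟩
  have hfar : 1 / 2 ≤ infDist ((3 / 2 : ℂ) * I) u.range := by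
    rw [Metric.le_infDist (UnbasedLoop.range_nonempty u), hru]
    exact fun y hy ↦ half_le_dist_of_mem_trace hy
  have key := UnbasedLoop.wind_eq_of_dist_lt (hlt.trans_le hfar)
  rw [UnbasedLoop.wind_reverse, hwv, hwu, if_pos threeHalves_I_mem] at key
  norm_num at key

end TwoMouth

open TwoMouth

/-- **Anchor (registered): the law-level reading of the refutation of `tame_rigidity`.**  Two random
configurations on `([0,1], Leb)` — deterministic: the one-loop configurations `{u}`, `{v}` of the two-mouth
lake and its rotation by `π`, filed under type `0` — both surely `Regular` AND `Tame`, whose loops have the SAME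
winding function (`udist u v ≥ 1/2`), hence with identical typed (joint) pattern counts for every disc family,
window and index set, surely; yet at coupling distance `cnLawEDist ≥ 1/2`.  Statistics that are functions of
`(trace, W, type)` do not identify laws on tame regular supports in `d_CN`. -/
theorem exists_tame_laws_windEq_le_cnLawEDist :
    ∃ X X' : unitInterval → LoopConfig ℂ,
      (∀ s, Regular (X s) ∧ ∀ u ∈ (X s).loops, Tame u) ∧ (∀ s, Regular (X' s) ∧ ∀ u ∈ (X' s).loops, Tame u) ∧
      (∃ u v : UnbasedLoop ℂ, (∀ s, (X s).loops = {u}) ∧ (∀ s, (X' s).loops = {v}) ∧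
        (∀ z, u.wind z = v.wind z) ∧ 1 / 2 ≤ u.udist v) ∧
      (∀ (s : unitInterval) (i : Fin 2) (n : ℕ) (x : Fin n → ℂ) (r : Fin n → ℝ) (R : ℝ) (S : Finset (Fin n)),
        typedPatternCount (X s) i x r R S = typedPatternCount (X' s) i x r R S) ∧
      ENNReal.ofReal (1 / 2) ≤ LoopConfig.cnLawEDist volume X volume X' := by
  obtain ⟨u, v, hu, hv, hwu, hwv, hru, hud⟩ := exists_pair
  have hw : ∀ z, u.wind z = v.wind z := fun z ↦ by rw [hwu, hwv]
  have hnot : ∀ ε : ℝ, 0 < ε → ε < 1 / 2 → ∀ _ω _ω' : unitInterval,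
      ¬ LoopConfig.IsClose ε (single 0 u) (single 0 v) := by
    intro ε hε hε2 _ _ h
    have hball : u.range ⊆ ball (0 : ℂ) (1 / ε) := fun y hy ↦ by
      rw [mem_ball, dist_zero_right]
      have h2 : (2 : ℝ) < 1 / ε := by rw [lt_one_div two_pos hε]; linarith
      exact (norm_le_two_of_mem_trace (hru ▸ hy)).trans_lt h2
    obtain ⟨v', hv', hd⟩ := (h 0).1 u (mem_single_self 0 u) hball
    have : v' = v := (eq_of_mem_single_F hv').1
    rw [this] at hd
    linarith
  refine ⟨fun _ ↦ single 0 u, fun _ ↦ single 0 v, fun _ ↦ ⟨regular_single hu 0, fun w hw' ↦ ?_⟩,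
    fun _ ↦ ⟨regular_single hv 0, fun w hw' ↦ ?_⟩,
    ⟨u, v, fun _ ↦ loops_single 0 u, fun _ ↦ loops_single 0 v, hw, hud⟩,
    fun _ i n x r R S ↦ typedPatternCount_single_eq hu hv hw i x r R S,
    le_cnLawEDist_of_forall_not_isClose _ _ (by norm_num) hnot⟩
  · rw [loops_single, mem_singleton_iff] at hw'; rw [hw']; exact hu
  · rw [loops_single, mem_singleton_iff] at hw'; rw [hw']; exact hv

end Summit.CriticalPhenomena.CardyFormulaZ2.Cruxes.NestingRigidity.PositiveConeWeightDoubling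

end
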